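import Mathlib
import Summits.ResolutionOfSingularities.ResolutionOfSingularities.Theorems.WildQuotientsWildQuotientResolutionS1W1NOStepTwo

/-!
# S1 / W1N cascade — Part VII.5–6: a cube cone at the type-N successor forces `μ ≤ 4`; the support `NStep`; discharge `nStep_holds`

Crux stmt-ResolutionOfSingularities-17941 (`WildQuotients.CyclicQuotientFourfolds`), S1a line `s1a-logminvertex`,
stub `stub_W1N_print`, sub-line `w1n-cascade` (idea-1 `W1N-LINE.md`; proofs from `CombinedW1NPrint.scratch.lean`
f33256b0cfc42851).  [OURS · L1 W4.5c] — NOT a statement of the manuscript; counted 0 post-V5.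

`milnor_le_four_of_hasTriple_sheared` (sheared type N, chart 1 at 0: `HasTriple θ'` ⇒ `2 = 0`, `b₂₀ = b₁₁ = 0 ≠ b₃₀`
⇒ `𝔪² ≤ (A,G) + 𝔪³` ⇒ Nakayama ⇒ `I(A,G) ≤ 2` ⇒ `μ(θ') ≤ 4`), its B3 transport, `nStep_unfolded` (by cases on
`HasTriple θ₁`: S3 kills «θ₂ bad», else the quantitative O-step), and `W1NCascade.nStep_holds : NStep`.
-/

-- single-problem summit: the doubled namespace component `ResolutionOfSingularities` is forced
set_option linter.dupNamespace false

noncomputable section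

open MvPowerSeries IsLocalRing
open Literature.AlgebraicGeometry.Resolution
open Summit.ResolutionOfSingularities.ResolutionOfSingularities.Theorems.WildCones.MuDropCharTwoOrdP

namespace Summit.ResolutionOfSingularities.ResolutionOfSingularities.Theorems.WildQuotientResolution.S1.PlanarField

variable {κ : Type} [Field κ]

/-! ### VII.5 The cone of the type-N successor: a cube forces `μ ≤ 4` -/

/-- SHEARED TYPE N, chart 1 at 0: if the cone of the isolated successor `θ' = (x·A, G)` is a cube
(`HasTriple θ'`), then `2 = 0` in `κ`, `b₂₀ = b₁₁ = 0 ≠ b₃₀`, and `μ(θ') = 2 + I(A,G) ≤ 4` — since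
`G + y·A ≡ b₃₀x²`, `x·A ≡ a₂₀x² + βxy`, `y·A ≡ a₂₀xy + βy² (mod 𝔪³)` give `𝔪² ≤ (A,G) + 𝔪³`, NAKAYAMA, and
`A ∈ (A,G)` has `∂A/∂y(0) = β ≠ 0`. [OURS · L1 W4.5c] -/
theorem milnor_le_four_of_hasTriple_sheared (θ θ' : PlanarField κ) (hiso : θ.IsIsolated) (hsing : θ.IsSingular)
    (h00 : θ.linearPart 0 0 = 0) (h01 : θ.linearPart 0 1 ≠ 0) (h10 : θ.linearPart 1 0 = 0)
    (h11 : θ.linearPart 1 1 = 0) (hsucc : IsSuccChart1 0 θ θ') (hiso' : θ'.IsIsolated)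
    (hT : ∃ lam u v : κ, lam ≠ 0 ∧ (u ≠ 0 ∨ v ≠ 0) ∧
      X 0 * θ'.b - X 1 * θ'.a - C lam * (C u * X 0 + C v * X 1) ^ 3 ∈ maximalIdeal (MvPowerSeries (Fin 2) κ) ^ 4) :
    θ'.milnor ≤ 4 := by
  classical
  obtain ⟨A, Bst, G, mb, hmb, hmb1, hA, hKA, hB, hKB, hνB, hG, hKG, ha', hb', hid, hA00, hG00, hG01, hG10,
    hfinAG, hfinAB, hμ', hF2, hF1, hF3, hF4⟩ := exists_typeN_setup θ θ' hiso hsing h01 hsucc hiso'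
  rw [h00] at hA00
  rw [h10] at hG00
  rw [h11, h00, sub_zero] at hG01
  -- `eG = 2`
  have heG : Module.finrank κ (MvPowerSeries (Fin 2) κ ⧸ Ideal.span {G, (X 0 : MvPowerSeries (Fin 2) κ)}) = 2 := by
    obtain ⟨-, heG'⟩ := colength_X_eq_order hKG
    have hfin : (((killCompl (⟨fun _ => (1 : Fin 2), fun a b _ => Subsingleton.elim a b⟩ : Fin 1 ↪ Fin 2) G).order.toNat
        : ℕ) : ℕ∞) = (killCompl (⟨fun _ => (1 : Fin 2), fun a b _ => Subsingleton.elim a b⟩ : Fin 1 ↪ Fin 2) G).order :=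
      ne_zero_iff_order_finite.mp hKG
    have hge : ((2 : ℕ) : ℕ∞) ≤ (killCompl (⟨fun _ => (1 : Fin 2), fun a b _ => Subsingleton.elim a b⟩ :
        Fin 1 ↪ Fin 2) G).order := by
      refine le_order_killCompl fun k hk => ?_
      interval_cases k
      · rw [Finsupp.single_zero, coeff_zero_eq_constantCoeff_apply, hG00]
      · exact hG01
    have h2 : 2 ≤ Module.finrank κ (MvPowerSeries (Fin 2) κ ⧸ Ideal.span {G, (X 0 : MvPowerSeries (Fin 2) κ)}) := by
      rw [Ideal.span_pair_comm, heG']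
      rw [← hfin] at hge
      exact_mod_cast hge
    omega
  -- jets of `A` and `G`:  `A ≡ a₂₀x + βy (mod 𝔪²)`, `G ≡ b₂₀x + b₃₀x² + (b₁₁ − a₂₀)xy − βy² (mod 𝔪³)`
  have hA10 : coeff (Finsupp.single 0 1) A = coeff (Finsupp.single 0 2) θ.a := by
    have h1 := coeff_subst_blow' θ.a 2 0
    simp only [add_zero, Finsupp.single_zero] at h1
    have h2 : coeff (Finsupp.single 0 2) (X 0 ^ 1 * A) = coeff (Finsupp.single 0 1) A := by
      rw [pow_one, show (Finsupp.single (0 : Fin 2) 2 : Fin 2 →₀ ℕ) = Finsupp.single 0 1 + Finsupp.single 0 1 from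
        by rw [← Finsupp.single_add], coeff_add_single_X_mul]
    rw [hA, h2] at h1
    exact h1
  have hA01 : coeff (Finsupp.single 1 1) A = θ.linearPart 0 1 := by
    have h1 := coeff_subst_blow' θ.a 0 1
    simp only [zero_add, Finsupp.single_zero] at h1
    have h2 : coeff (Finsupp.single 0 1 + Finsupp.single 1 1) (X 0 ^ 1 * A) = coeff (Finsupp.single 1 1) A := by
      rw [pow_one, coeff_add_single_X_mul]
    rw [hA, h2] at h1
    rw [linearPart_apply_zero]
    exact h1
  have hGx2 : ∀ d : Fin 2 →₀ ℕ, coeff (Finsupp.single 0 2 + d)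
      (subst (![X 0, X 0 * X 1] : Fin 2 → MvPowerSeries (Fin 2) κ) (X 0 * θ.b - X 1 * θ.a)) = coeff d G := by
    intro d; rw [hG, coeff_add_X_pow_mul]
  have hG20 : coeff (Finsupp.single 0 2) G = coeff (Finsupp.single 0 3) θ.b := by
    rw [← coeff_g_four_zero θ, ← hGx2 (Finsupp.single 0 2)]
    have h1 := coeff_subst_blow' (X 0 * θ.b - X 1 * θ.a) 4 0
    simp only [add_zero, Finsupp.single_zero] at h1
    rw [← Finsupp.single_add, h1]
  have hG11 : coeff (Finsupp.single 0 1 + Finsupp.single 1 1) G =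
      coeff (Finsupp.single 0 1 + Finsupp.single 1 1) θ.b - coeff (Finsupp.single 0 2) θ.a := by
    rw [← coeff_g_two_one θ, ← hGx2 (Finsupp.single 0 1 + Finsupp.single 1 1)]
    have h1 := coeff_subst_blow' (X 0 * θ.b - X 1 * θ.a) 2 1
    rw [← h1, ← add_assoc, ← Finsupp.single_add]
  have hG02 : coeff (Finsupp.single 1 2) G = - θ.linearPart 0 1 := by
    rw [linearPart_apply_zero, ← coeff_g_zero_two θ, ← hGx2 (Finsupp.single 1 2)]
    have h1 := coeff_subst_blow' (X 0 * θ.b - X 1 * θ.a) 0 2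
    simp only [zero_add, Finsupp.single_zero] at h1
    exact h1
  -- the 3-jet (and `g'₂₀`) of `g' = x·b' − y·a'`, `θ' = (x·A, G)`
  have hxA20 : coeff (Finsupp.single 0 2) (X 0 * A) = coeff (Finsupp.single 0 1) A := by
    rw [show (Finsupp.single (0 : Fin 2) 2 : Fin 2 →₀ ℕ) = Finsupp.single 0 1 + Finsupp.single 0 1 from
      by rw [← Finsupp.single_add], coeff_add_single_X_mul]
  have hg'03 : coeff (Finsupp.single 1 3) (X 0 * θ'.b - X 1 * θ'.a) = 0 := by
    rw [coeff_g_zero_three, ha', coeff_X_mul_of_apply_eq_zero 0 (by simp) A, neg_zero]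
  have hg'12 : coeff (Finsupp.single 0 1 + Finsupp.single 1 2) (X 0 * θ'.b - X 1 * θ'.a) =
      - θ.linearPart 0 1 - θ.linearPart 0 1 := by
    rw [coeff_g_one_two, hb', hG02, ha', coeff_add_single_X_mul, hA01]
  have hg'21 : coeff (Finsupp.single 0 2 + Finsupp.single 1 1) (X 0 * θ'.b - X 1 * θ'.a) =
      (coeff (Finsupp.single 0 1 + Finsupp.single 1 1) θ.b - coeff (Finsupp.single 0 2) θ.a)
        - coeff (Finsupp.single 0 2) θ.a := by
    rw [coeff_g_two_one, hb', hG11, ha', hxA20, hA10]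
  have hg'30 : coeff (Finsupp.single 0 3) (X 0 * θ'.b - X 1 * θ'.a) = coeff (Finsupp.single 0 3) θ.b := by
    rw [coeff_g_three_zero, hb', hG20]
  have hg'20 : coeff (Finsupp.single 0 2) (X 0 * θ'.b - X 1 * θ'.a) = coeff (Finsupp.single 0 2) θ.b := by
    rw [coeff_g_two_zero, hb', hG10]
  -- consequences of `HasTriple θ'`
  obtain ⟨lam, u, v, hlam, huv, hmem⟩ := hT
  have E03 := Literature.RingTheory.MvPowerSeries.Jets.coeff_eq_zero_of_mem_maximalIdeal_pow hmem
    (e := Finsupp.single 1 3) (by rw [Finsupp.degree_single]; norm_num)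
  rw [map_sub, coeff_C_mul, coeff_cube_zero_three, hg'03] at E03
  have hv : v = 0 := by
    have h : lam * v ^ 3 = 0 := by linear_combination -E03
    exact (pow_eq_zero_iff three_ne_zero).mp ((mul_eq_zero.mp h).resolve_left hlam)
  have hu : u ≠ 0 := huv.resolve_right (fun h => h hv)
  have E12 := Literature.RingTheory.MvPowerSeries.Jets.coeff_eq_zero_of_mem_maximalIdeal_pow hmem
    (e := Finsupp.single 0 1 + Finsupp.single 1 2)
    (by rw [map_add, Finsupp.degree_single, Finsupp.degree_single]; norm_num)
  rw [map_sub, coeff_C_mul, coeff_cube_one_two, hg'12, hv] at E12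
  have h2 : (2 : κ) = 0 := by
    have h : (2 : κ) * θ.linearPart 0 1 = 0 := by linear_combination (-1 : κ) * E12
    exact (mul_eq_zero.mp h).resolve_right h01
  have E21 := Literature.RingTheory.MvPowerSeries.Jets.coeff_eq_zero_of_mem_maximalIdeal_pow hmem
    (e := Finsupp.single 0 2 + Finsupp.single 1 1)
    (by rw [map_add, Finsupp.degree_single, Finsupp.degree_single]; norm_num)
  rw [map_sub, coeff_C_mul, coeff_cube_two_one, hg'21, hv] at E21
  have hb11 : coeff (Finsupp.single 0 1 + Finsupp.single 1 1) θ.b = 0 := by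
    linear_combination E21 + coeff (Finsupp.single 0 2) θ.a * h2
  have E30 := Literature.RingTheory.MvPowerSeries.Jets.coeff_eq_zero_of_mem_maximalIdeal_pow hmem
    (e := Finsupp.single 0 3) (by rw [Finsupp.degree_single]; norm_num)
  rw [map_sub, coeff_C_mul, coeff_cube_three_zero, hg'30] at E30
  have hb30 : coeff (Finsupp.single 0 3) θ.b ≠ 0 := by
    intro h0
    rw [h0, zero_sub, neg_eq_zero] at E30
    exact mul_ne_zero hlam (pow_ne_zero 3 hu) E30
  have E20 := Literature.RingTheory.MvPowerSeries.Jets.coeff_eq_zero_of_mem_maximalIdeal_pow hmem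
    (e := Finsupp.single 0 2) (by rw [Finsupp.degree_single]; norm_num)
  rw [map_sub, coeff_C_mul, coeff_cube_two_zero, hg'20, mul_zero, sub_zero] at E20
  -- `E20 : b₂₀ = 0`
  have hG10z : coeff (Finsupp.single 0 1) G = 0 := by rw [hG10, E20]
  -- NAKAYAMA for `I = (A, G)`
  have hX0 : (X 0 : MvPowerSeries (Fin 2) κ) ∈ maximalIdeal (MvPowerSeries (Fin 2) κ) :=
    mem_maximalIdeal_of_constantCoeff_eq_zero (constantCoeff_X 0)
  have hX1 : (X 1 : MvPowerSeries (Fin 2) κ) ∈ maximalIdeal (MvPowerSeries (Fin 2) κ) :=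
    mem_maximalIdeal_of_constantCoeff_eq_zero (constantCoeff_X 1)
  have hm3 : ∀ {p q : MvPowerSeries (Fin 2) κ}, p ∈ maximalIdeal (MvPowerSeries (Fin 2) κ) →
      q ∈ maximalIdeal (MvPowerSeries (Fin 2) κ) ^ 2 → p * q ∈ maximalIdeal (MvPowerSeries (Fin 2) κ) ^ 3 :=
    fun hp hq => by rw [pow_succ']; exact Ideal.mul_mem_mul hp hq
  have hAI : A ∈ Ideal.span {A, G} := Ideal.subset_span (by simp)
  have hGI : G ∈ Ideal.span {A, G} := Ideal.subset_span (by simp)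
  have rA : A - C (coeff (Finsupp.single 0 2) θ.a) * X 0 - C (θ.linearPart 0 1) * X 1 ∈
      maximalIdeal (MvPowerSeries (Fin 2) κ) ^ 2 := by
    have h := sub_jet_one_mem_maximalIdeal_sq A
    rwa [hA00, map_zero, sub_zero, hA10, hA01] at h
  have rG : G - C (coeff (Finsupp.single 0 3) θ.b) * X 0 ^ 2
      - C (coeff (Finsupp.single 0 1 + Finsupp.single 1 1) θ.b - coeff (Finsupp.single 0 2) θ.a) * (X 0 * X 1)
      - C (- θ.linearPart 0 1) * X 1 ^ 2 ∈ maximalIdeal (MvPowerSeries (Fin 2) κ) ^ 3 := by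
    refine mem_maximalIdeal_pow_of_coeff_pair 3 fun i j hij => ?_
    simp only [map_sub (coeff (Finsupp.single (0 : Fin 2) i + Finsupp.single 1 j)), coeff_C_mul,
      coeff_pair_X_zero_sq, coeff_pair_X_one_sq, coeff_pair_X_zero_mul_X_one]
    have hi : i ≤ 2 := by omega
    have hj : j ≤ 2 := by omega
    interval_cases i <;> interval_cases j <;> first | omega | simp [hG00, hG10z, hG01, hG20, hG11, hG02]
  -- `x², xy, y² ∈ (A,G) + 𝔪³`
  have hxx : (X 0 ^ 2 : MvPowerSeries (Fin 2) κ) ∈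
      Ideal.span {A, G} ⊔ maximalIdeal (MvPowerSeries (Fin 2) κ) ^ 3 := by
    have h1 : C (coeff (Finsupp.single 0 3) θ.b) * X 0 ^ 2 = (G + X 1 * A)
        - (G - C (coeff (Finsupp.single 0 3) θ.b) * X 0 ^ 2
          - C (coeff (Finsupp.single 0 1 + Finsupp.single 1 1) θ.b - coeff (Finsupp.single 0 2) θ.a) * (X 0 * X 1)
          - C (- θ.linearPart 0 1) * X 1 ^ 2)
        - X 1 * (A - C (coeff (Finsupp.single 0 2) θ.a) * X 0 - C (θ.linearPart 0 1) * X 1)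
        - C (coeff (Finsupp.single 0 1 + Finsupp.single 1 1) θ.b) * (X 0 * X 1) := by
      simp only [map_sub, map_neg]
      ring
    have hm : C (coeff (Finsupp.single 0 3) θ.b) * X 0 ^ 2 ∈
        Ideal.span {A, G} ⊔ maximalIdeal (MvPowerSeries (Fin 2) κ) ^ 3 := by
      rw [h1]
      refine Submodule.sub_mem _ (Submodule.sub_mem _ (Submodule.sub_mem _
        (Ideal.mem_sup_left (Ideal.add_mem _ hGI (Ideal.mul_mem_left _ _ hAI))) (Ideal.mem_sup_right rG))
        (Ideal.mem_sup_right (hm3 hX1 rA))) ?_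
      rw [hb11, map_zero, zero_mul]
      exact Submodule.zero_mem _
    have h3 := Ideal.mul_mem_left _ (C (coeff (Finsupp.single 0 3) θ.b)⁻¹) hm
    rwa [← mul_assoc, ← map_mul, inv_mul_cancel₀ hb30, map_one, one_mul] at h3
  have hxy : (X 0 * X 1 : MvPowerSeries (Fin 2) κ) ∈
      Ideal.span {A, G} ⊔ maximalIdeal (MvPowerSeries (Fin 2) κ) ^ 3 := by
    have h1 : C (θ.linearPart 0 1) * (X 0 * X 1) =
        X 0 * A - X 0 * (A - C (coeff (Finsupp.single 0 2) θ.a) * X 0 - C (θ.linearPart 0 1) * X 1)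
          - C (coeff (Finsupp.single 0 2) θ.a) * X 0 ^ 2 := by ring
    have hm : C (θ.linearPart 0 1) * (X 0 * X 1) ∈
        Ideal.span {A, G} ⊔ maximalIdeal (MvPowerSeries (Fin 2) κ) ^ 3 := by
      rw [h1]
      exact Submodule.sub_mem _ (Submodule.sub_mem _ (Ideal.mem_sup_left (Ideal.mul_mem_left _ _ hAI))
        (Ideal.mem_sup_right (hm3 hX0 rA))) (Ideal.mul_mem_left _ _ hxx)
    have h3 := Ideal.mul_mem_left _ (C (θ.linearPart 0 1)⁻¹) hm
    rwa [← mul_assoc, ← map_mul, inv_mul_cancel₀ h01, map_one, one_mul] at h3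
  have hyy : (X 1 ^ 2 : MvPowerSeries (Fin 2) κ) ∈
      Ideal.span {A, G} ⊔ maximalIdeal (MvPowerSeries (Fin 2) κ) ^ 3 := by
    have h1 : C (θ.linearPart 0 1) * X 1 ^ 2 =
        X 1 * A - X 1 * (A - C (coeff (Finsupp.single 0 2) θ.a) * X 0 - C (θ.linearPart 0 1) * X 1)
          - C (coeff (Finsupp.single 0 2) θ.a) * (X 0 * X 1) := by ring
    have hm : C (θ.linearPart 0 1) * X 1 ^ 2 ∈
        Ideal.span {A, G} ⊔ maximalIdeal (MvPowerSeries (Fin 2) κ) ^ 3 := by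
      rw [h1]
      exact Submodule.sub_mem _ (Submodule.sub_mem _ (Ideal.mem_sup_left (Ideal.mul_mem_left _ _ hAI))
        (Ideal.mem_sup_right (hm3 hX1 rA))) (Ideal.mul_mem_left _ _ hxy)
    have h3 := Ideal.mul_mem_left _ (C (θ.linearPart 0 1)⁻¹) hm
    rwa [← mul_assoc, ← map_mul, inv_mul_cancel₀ h01, map_one, one_mul] at h3
  have hm2I : maximalIdeal (MvPowerSeries (Fin 2) κ) ^ 2 ≤ Ideal.span {A, G} :=
    maximalIdeal_sq_le_of_le_sup (maximalIdeal_sq_le hxx hxy hyy)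
  have hIAG : Module.finrank κ (MvPowerSeries (Fin 2) κ ⧸ Ideal.span {A, G}) ≤ 2 :=
    finrank_quot_le_two_of_sq_le hm2I hAI hA00 (by rw [hA01]; exact h01)
  rw [hμ', heG]
  omega

/-- **A cube cone forces `μ ≤ 4`**, any successor: if an isolated bad node `θ` with `linearPart θ ≠ 0` has a
bad isolated successor `θ'` whose cubic cone is a cube (`HasTriple θ'`), then `μ(θ') ≤ 4` (B3 transport +
`milnor_le_four_of_hasTriple_sheared`). [OURS · L1 W4.5c] -/
theorem milnor_le_four_of_hasTriple_of_isSucc (θ θ' : PlanarField κ) (hiso : θ.IsIsolated)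
    (hbad : θ.IsBadNode) (hL : θ.linearPart ≠ 0) (hsucc : θ.IsSucc θ') (hiso' : θ'.IsIsolated)
    (hbad' : θ'.IsBadNode)
    (hT : ∃ lam u v : κ, lam ≠ 0 ∧ (u ≠ 0 ∨ v ≠ 0) ∧
      X 0 * θ'.b - X 1 * θ'.a - C lam * (C u * X 0 + C v * X 1) ^ 3 ∈ maximalIdeal (MvPowerSeries (Fin 2) κ) ^ 4) :
    θ'.milnor ≤ 4 := by
  revert hiso hbad hL hiso' hbad' hT
  refine forall_isSucc_of_chart1_zero
    (P := fun θ θ' => θ.IsIsolated → θ.IsBadNode → θ.linearPart ≠ 0 → θ'.IsIsolated → θ'.IsBadNode →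
      (∃ lam u v : κ, lam ≠ 0 ∧ (u ≠ 0 ∨ v ≠ 0) ∧
        X 0 * θ'.b - X 1 * θ'.a - C lam * (C u * X 0 + C v * X 1) ^ 3 ∈
          maximalIdeal (MvPowerSeries (Fin 2) κ) ^ 4) → θ'.milnor ≤ 4)
    ?_ ?_ ?_ θ θ' hsucc
  · intro c θ θ' h hiso hbad hL hiso' hbad' hT
    exact h ((isIsolated_shear_iff c θ).mpr hiso) ((isBadNode_shear_iff c θ).mpr hbad)
      (fun h0 => hL ((linearPart_shear_eq_zero_iff c θ).mp h0)) hiso' hbad' hT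
  · intro θ θ' h hiso hbad hL hiso' hbad' hT
    have := h ((isIsolated_swapField_iff θ).mpr hiso) ((isBadNode_swapField_iff θ).mpr hbad)
      (fun h0 => hL ((linearPart_swapField_eq_zero_iff θ).mp h0)) ((isIsolated_swapField_iff θ').mpr hiso')
      ((isBadNode_swapField_iff θ').mpr hbad') (hasTriple_swapField θ' hT)
    rwa [milnor_swapField] at this
  · intro θ θ' h hiso hbad hL hiso' hbad' hT
    obtain ⟨⟨h00, h01, h10, h11⟩, -⟩ := typeN_chart1_zero_step θ θ' hiso hbad hL h hiso' hbad'
    exact milnor_le_four_of_hasTriple_sheared θ θ' hiso hbad.1 h00 h01 h10 h11 h hiso' hT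

/-! ### VII.6 The support `NStep` -/

/-- **The support `NStep`, unfolded.**  From an isolated bad node `θ` of type N with `μ(θ) ≥ 3`, along
successors `θ → θ₁ → θ₂` with `θ₁, θ₂` isolated bad: `μ(θ₂) < μ(θ)`.  By the strong type-N step `θ₁` is of
type O with `μ(θ₁) ≤ μ(θ) + 1`.  If the cone of `θ₁` is a cube then `μ(θ₁) ≤ 4` and `θ₁` has no bad isolated
successor (S3) — contradiction; otherwise the quantitative O-step gives `μ(θ₂) + 2 ≤ μ(θ₁) ≤ μ(θ) + 1`.
[OURS · L1 W4.5c] -/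
theorem nStep_unfolded (θ θ₁ θ₂ : PlanarField κ) (hiso : θ.IsIsolated) (hbad : θ.IsBadNode)
    (hL : θ.linearPart ≠ 0) (hμ : 3 ≤ θ.milnor) (h₁ : θ.IsSucc θ₁) (h₂ : θ₁.IsSucc θ₂)
    (hiso₁ : θ₁.IsIsolated) (hbad₁ : θ₁.IsBadNode) (hiso₂ : θ₂.IsIsolated) (hbad₂ : θ₂.IsBadNode) :
    θ₂.milnor < θ.milnor := by
  obtain ⟨hL₁, hle₁⟩ := typeN_step_linearPart_eq_zero θ θ₁ hiso hbad hL hμ h₁ hiso₁ hbad₁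
  by_cases hT : ∃ lam u v : κ, lam ≠ 0 ∧ (u ≠ 0 ∨ v ≠ 0) ∧
      X 0 * θ₁.b - X 1 * θ₁.a - C lam * (C u * X 0 + C v * X 1) ^ 3 ∈ maximalIdeal (MvPowerSeries (Fin 2) κ) ^ 4
  · have hμ₁ := milnor_le_four_of_hasTriple_of_isSucc θ θ₁ hiso hbad hL h₁ hiso₁ hbad₁ hT
    exact absurd hbad₂ (not_isBadNode_of_milnor_le_four_of_isSucc θ₁ θ₂ hiso₁ hbad₁ hL₁ hμ₁ h₂ hiso₂)
  · have h2 := milnor_add_two_le_of_isSucc θ₁ θ₂ hiso₁ hbad₁ hL₁ hT h₂ hiso₂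
    omega

end Summit.ResolutionOfSingularities.ResolutionOfSingularities.Theorems.WildQuotientResolution.S1.PlanarField

namespace Summit.ResolutionOfSingularities.ResolutionOfSingularities.Theorems.WildQuotientResolution.S1.W1NCascade

/-- **Discharge of the support `NStep`** (type N with `μ ≥ 3`: the Milnor number drops after two bad steps). -/
theorem nStep_holds : NStep := fun _ _ θ θ₁ θ₂ => PlanarField.nStep_unfolded θ θ₁ θ₂

end Summit.ResolutionOfSingularities.ResolutionOfSingularities.Theorems.WildQuotientResolution.S1.W1NCascade

end
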